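import Summits.CriticalPhenomena.PercolationContinuityZ3.Theorems.Transplant.FKDoubleFanWedge
import Summits.CriticalPhenomena.PercolationContinuityZ3.Theorems.Transplant.FKDoubleFanSameApex
import Summits.CriticalPhenomena.PercolationContinuityZ3.Theorems.Transplant.FKThreeApexNegCorr
import HarnessLib

/-!
# Double fans `K₂ ∨ P_{m+1}`: walking the middle word with an operator cone — the termwise route to the far cross-apex pair

Helper file (`--supports stmt-CriticalPhenomena-4575`), FK sub-lane `prim-bschramm-fk-3` (gen 27); builds on p205010 (kernel theorem, internal
audit signed; external expert review pending).  No named facts, no sorries; standard axioms.  Memo `bschramm/prim-bschramm-fk-3/FAR-CROSS-II.md` §5, §7.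

With the bivector calculus of `…DoubleFanWedge` (`wedgeH`, `pairH`, the six operators, `IsOpCone`): an operator cone is stable under the whole middle
word `midWord` of `…DoubleFanSameApex` (**`IsOpCone.wedgeH_midWord_mem`**), hence (**`rayleigh_word_of_isOpCone`**) if it contains the u-side pair
bivector and pairs non-negatively with the s-side one, the pinned Rayleigh inequality `Z¹¹Z⁰⁰ ≤ Z¹⁰Z⁰¹` holds after any double-fan word — instances:
**`rayleigh_crossFar_of_isOpCone`** (`crossFarZ` of `…DoubleFanCrossFar` unfolded: the hypothesis `halg` of `negCorr_spokes_cross_far_of_inKE`),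
**`rayleigh_sameApexFar_of_isOpCone`** (`sameApexZ`), **`rayleigh_rimSpokeFar_of_isOpCone`** (rim edge vs. spoke).
What remains for negative correlation at all distances (for a range of `q`) is to EXHIBIT such a cone (memo §5: CONJECTURE T, numerically for q ≥ 1/2).
[cite: Grimmett2006, §3.9 eq. (3.94) (pp. 63–64)] [folklore]
-/

noncomputable section

namespace Summit.CriticalPhenomena.PercolationContinuityZ3.Theorems

namespace FK

namespace ThreeApex

/-! ### Walking a double-fan word -/

namespace IsOpCone

variable {q : ℝ} {K : Set Biv}

/-- **The middle word keeps the pair bivector in the cone**: for blocks with weights in `[0,1]`,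
`wedgeH (midWord q mids X) (midWord q mids Y) ∈ K` whenever `wedgeH X Y ∈ K`. [folklore] -/
theorem wedgeH_midWord_mem (hK : IsOpCone q K) :
    ∀ {mids : List (ℝ × ℝ × ℝ)}, UnitBlocks mids → ∀ {X Y : V5}, wedgeH X Y ∈ K → wedgeH (midWord q mids X) (midWord q mids Y) ∈ K := by
  intro mids
  induction mids with
  | nil => intro _ X Y h; simpa [midWord] using h
  | cons blk rest ih =>
    intro hm X Y h
    have hb := hm blk (by simp)
    have hrest : UnitBlocks rest := fun b hb' => hm b (by simp [hb'])
    simp only [midWord]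
    exact ih hrest (hK.wedgeH_conv_edgeAC_mem hb.2.2.1 hb.2.2.2.1
      (hK.wedgeH_conv_edgeBC_mem hb.2.2.2.2.1 hb.2.2.2.2.2 (hK.wedgeH_rimStep_mem hb.1 hb.2.1 h)))

end IsOpCone

/-- **THE TERMWISE ROUTE, GENERIC FORM.**  Let `W = E_{r_d} ∘ midWord mids` be a double-fan word (weights in `[0,1]`).  If the u-side pair bivector
`X₀ ∧ X₁` lies in an operator cone `K` all of whose elements pair non-negatively with the s-side pair bivector `Y₀ ∧ Y₁`, then
`val(Y₁ ∗ W X₁)·val(Y₀ ∗ W X₀) ≤ val(Y₀ ∗ W X₁)·val(Y₁ ∗ W X₀)` — the pinned Rayleigh inequality for ANY pair of pins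
(`(X₀,X₁) = (u, P_a u)` for an `a`-spoke, `(u, P_b u)` for a `b`-spoke, `(detach u, u)` for a rim edge; likewise for `(Y₀,Y₁)`). [folklore] -/
theorem rayleigh_word_of_isOpCone {q : ℝ} {K : Set Biv} (hK : IsOpCone q K) {mids : List (ℝ × ℝ × ℝ)} (hm : UnitBlocks mids)
    {rd : ℝ} (hrd0 : 0 ≤ rd) (hrd1 : rd ≤ 1) {X₀ X₁ Y₀ Y₁ : V5} (hu : wedgeH X₀ X₁ ∈ K)
    (hs : ∀ β, β ∈ K → 0 ≤ pairH q β (wedgeH Y₀ Y₁)) :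
    val q (conv Y₁ (rimStep q rd (midWord q mids X₁))) * val q (conv Y₀ (rimStep q rd (midWord q mids X₀))) ≤
      val q (conv Y₀ (rimStep q rd (midWord q mids X₁))) * val q (conv Y₁ (rimStep q rd (midWord q mids X₀))) := by
  have hmem : wedgeH (rimStep q rd (midWord q mids X₀)) (rimStep q rd (midWord q mids X₁)) ∈ K :=
    hK.wedgeH_rimStep_mem hrd0 hrd1 (hK.wedgeH_midWord_mem hm hu)
  have key := rayleigh_of_isOpCone hmem hs
  have e : ∀ X Y : V5, conv Y X = conv X Y := fun X Y => by simp only [← mul_def]; ac_rfl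
  rw [e _ Y₁, e _ Y₀, e _ Y₀, e _ Y₁]
  linarith [key]

/-- **The far cross-apex pair** (`crossFarZ` of `…DoubleFanCrossFar`, unfolded; `edgeAC 0 ∗ u = u`): if `K ∋ u ∧ P_a u` and `K` pairs
non-negatively with `s ∧ P_b s`, then `Z¹¹Z⁰⁰ ≤ Z¹⁰Z⁰¹` for every block list and last rim weight in `[0,1]` — the hypothesis `halg` of
`negCorr_spokes_cross_far_of_inKE`, hence negative correlation of `(a c_j, b c_k)` at every distance. [folklore] -/
theorem rayleigh_crossFar_of_isOpCone {q : ℝ} {K : Set Biv} (hK : IsOpCone q K) {mids : List (ℝ × ℝ × ℝ)} (hm : UnitBlocks mids)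
    {rd : ℝ} (hrd0 : 0 ≤ rd) (hrd1 : rd ≤ 1) {u s : V5}
    (hu : wedgeH (conv (edgeAC 0) u) (conv (edgeAC 1) u) ∈ K)
    (hs : ∀ β, β ∈ K → 0 ≤ pairH q β (wedgeH (conv (edgeBC 0) s) (conv (edgeBC 1) s))) :
    val q (conv s (conv (edgeBC 1) (rimStep q rd (midWord q mids (conv (edgeAC 1) u))))) *
        val q (conv s (conv (edgeBC 0) (rimStep q rd (midWord q mids (conv (edgeAC 0) u))))) ≤
      val q (conv s (conv (edgeBC 0) (rimStep q rd (midWord q mids (conv (edgeAC 1) u))))) *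
        val q (conv s (conv (edgeBC 1) (rimStep q rd (midWord q mids (conv (edgeAC 0) u))))) := by
  have key := rayleigh_word_of_isOpCone hK hm hrd0 hrd1 hu hs
  have e : ∀ (τ : ℝ) (X : V5), conv s (conv (edgeBC τ) X) = conv (conv (edgeBC τ) s) X := by
    intro τ X; simp only [← mul_def]; ac_rfl
  simp only [e]
  exact key

/-- **Two spokes of the same apex at any distance** (`sameApexZ` of `…DoubleFanSameApex`, unfolded): the same reduction with `P_a`-pins on both
sides (a new proof route for the theorem of `…DoubleFanSameApex` once a cone is exhibited; recorded for uniformity). [folklore] -/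
theorem rayleigh_sameApexFar_of_isOpCone {q : ℝ} {K : Set Biv} (hK : IsOpCone q K) {mids : List (ℝ × ℝ × ℝ)} (hm : UnitBlocks mids)
    {rd : ℝ} (hrd0 : 0 ≤ rd) (hrd1 : rd ≤ 1) {u s : V5}
    (hu : wedgeH (conv (edgeAC 0) u) (conv (edgeAC 1) u) ∈ K)
    (hs : ∀ β, β ∈ K → 0 ≤ pairH q β (wedgeH (conv (edgeAC 0) s) (conv (edgeAC 1) s))) :
    val q (conv s (conv (edgeAC 1) (rimStep q rd (midWord q mids (conv (edgeAC 1) u))))) *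
        val q (conv s (conv (edgeAC 0) (rimStep q rd (midWord q mids (conv (edgeAC 0) u))))) ≤
      val q (conv s (conv (edgeAC 0) (rimStep q rd (midWord q mids (conv (edgeAC 1) u))))) *
        val q (conv s (conv (edgeAC 1) (rimStep q rd (midWord q mids (conv (edgeAC 0) u))))) := by
  have key := rayleigh_word_of_isOpCone hK hm hrd0 hrd1 hu hs
  have e : ∀ (τ : ℝ) (X : V5), conv s (conv (edgeAC τ) X) = conv (conv (edgeAC τ) s) X := by
    intro τ X; simp only [← mul_def]; ac_rfl
  simp only [e]
  exact key

/-- **A rim edge against a spoke at any distance**: the rim edge `c_j c_{j+1}` pinned on the u side (`E_0 u = detach u` closed, `E_1 u = u` open),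
a `b`-spoke pinned on the s side. [folklore] -/
theorem rayleigh_rimSpokeFar_of_isOpCone {q : ℝ} {K : Set Biv} (hK : IsOpCone q K) {mids : List (ℝ × ℝ × ℝ)} (hm : UnitBlocks mids)
    {rd : ℝ} (hrd0 : 0 ≤ rd) (hrd1 : rd ≤ 1) {u s : V5}
    (hu : wedgeH (rimStep q 0 u) (rimStep q 1 u) ∈ K)
    (hs : ∀ β, β ∈ K → 0 ≤ pairH q β (wedgeH (conv (edgeBC 0) s) (conv (edgeBC 1) s))) :
    val q (conv s (conv (edgeBC 1) (rimStep q rd (midWord q mids (rimStep q 1 u))))) *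
        val q (conv s (conv (edgeBC 0) (rimStep q rd (midWord q mids (rimStep q 0 u))))) ≤
      val q (conv s (conv (edgeBC 0) (rimStep q rd (midWord q mids (rimStep q 1 u))))) *
        val q (conv s (conv (edgeBC 1) (rimStep q rd (midWord q mids (rimStep q 0 u))))) := by
  have key := rayleigh_word_of_isOpCone hK hm hrd0 hrd1 hu hs
  have e : ∀ (τ : ℝ) (X : V5), conv s (conv (edgeBC τ) X) = conv (conv (edgeBC τ) s) X := by
    intro τ X; simp only [← mul_def]; ac_rfl
  simp only [e]
  exact key

end ThreeApex

end FK

end Summit.CriticalPhenomena.PercolationContinuityZ3.Theorems
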